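import Mathlib.Analysis.Calculus.FDeriv.Symmetric
import Mathlib.Analysis.Calculus.ParametricIntegral
import Mathlib.Analysis.Calculus.Deriv.Mul
import Mathlib.MeasureTheory.Integral.Bochner.Set
import Literature.Analysis.FluidPDE.ClassicalSolutionCalculus
import HarnessLib

/-!
# Space–time calculus for jointly smooth fields on an open time set: exchange of `∂ₜ` and `D`

Analysis/FluidPDE support file (serves the discharge of `Literature.Analysis.FluidPDE.tao2011_velocity_eq_of_memSobolevX`,
Tao 2011, Cor. 4.3 + Thm. 5.4 (iii), by the vorticity energy method, where the time derivative of
the vorticity `curl u(t)` of a classical solution is `curl ∂ₜu(t)`, i.e. one exchanges `∂ₜ` with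
the spatial derivative).

For a time-dependent field `w : ℝ → X → F` the tree's smoothness notion is
`Fluid.IsSmoothSpaceTimeOn S w` (`uncurry w` is `C^∞` on `S ×ˢ univ`, `ClassicalSolution`), and the
equations are written with the *slice* operators `fderiv ℝ (w t) x`,
`Fluid.timeDerivWithin S w t x = derivWithin (w · x) S t`. The closed-slab dictionary (joint
smoothness of `(t, x) ↦ D(w t)(x)`, of `timeDerivWithin S w`, the formula
`timeDerivWithin S w t x = D(uncurry w)(t,x)(1,0)`) is in `ClassicalSolutionCalculus` and
`TaoEnstrophyLocalisation` (`IsSmoothSpaceTimeOn.fderiv_slice`, `.timeDerivWithin_eq`, …). This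
file adds the **open time set** dictionary, where two-sided derivatives are available and
Schwarz's theorem applies:

* `hasFDerivAt_slice`, `hasDerivAt_timeLine` (+ `Within` forms): slice derivatives are the
  restrictions `D(uncurry w)(t,x) ∘ (0, ·)` and `D(uncurry w)(t,x)(1,0)` of the joint derivative;
* `fderiv_slice_of_isOpen`, `deriv_timeLine`, `timeDerivWithin_eq_deriv`, smoothness of the fields
  `∂ₐw` (`isSmoothSpaceTimeOn_fderiv_apply`), `Dw` (`isSmoothSpaceTimeOn_fderiv_of_isOpen`) and
  `∂ₜw` (`isSmoothSpaceTimeOn_deriv`);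
* the **exchange of `∂ₜ` and `∂ₐ`**: `deriv_fderiv_slice_eq_fderiv_deriv` (Schwarz's theorem for
  the jointly `C²` field), in `HasDerivAt` form `hasDerivAt_fderiv_slice`, and the operator-valued
  form `hasDerivAt_fderiv_slice_clm` (`d/dt D(w t)(x) = D(∂ₜw(t,·))(x)` in `X →L[ℝ] F`);
* small algebra (`smul`, `mul`, `clm`, `inner`, time-independent fields) complementing
  `ClassicalSolutionCalculus`;
* parametric integrals of fields with uniformly compact spatial support: continuity
  (`continuousOn_integral_of_support_subset`) and differentiation under the integral sign
  (`hasDerivAt_integral_of_support_subset`).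

## Mathlib search

Everything is a thin layer over Mathlib: `HasFDerivAt.comp` with `hasFDerivAt_prodMk_left/right`,
`ContDiffOn.fderiv_of_isOpen`, `ContDiffAt.isSymmSndFDerivAt` (Schwarz), `HasDerivAt.clm_comp`,
`hasDerivAt_integral_of_dominated_loc_of_deriv_le`,
`continuousOn_integral_bilinear_of_locally_integrable_of_compact_support`. Mathlib has no
"curried" versions of these (searched `uncurry`, `slice` in `Analysis/Calculus`: only
`ContDiff.curry`-type statements for `ContinuousMultilinearMap`s), hence this file. The tree's
`IsSmoothSpaceTimeOn.fderiv_slice`/`.fderiv_slice_eq` (`TaoEnstrophyLocalisation`) are the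
`fderivWithin` (closed time set) counterparts of `fderiv_slice_of_isOpen`; no name is reused.

## References

* L. C. Evans, *Partial Differential Equations*, 2nd ed. (2010), App. C.1–C.2 (notation for
  partial derivatives, differentiation under the integral sign in §5 and §7.1.2 (energy
  estimates: "multiply by `uₜ` and integrate")).
* T. Tao, arXiv:1108.1165 = Anal. PDE 6 (2013), §5 (energy estimates for smooth solutions).
-/

noncomputable section

open MeasureTheory Set Function Filter Topology
open scoped ContDiff

namespace Literature.Analysis.FluidPDE

section Slices

variable {X : Type*} [NormedAddCommGroup X] [NormedSpace ℝ X]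
variable {F : Type*} [NormedAddCommGroup F] [NormedSpace ℝ F]
variable {w : ℝ → X → F} {t : ℝ} {x : X}

/-! ### Slice derivatives as restrictions of the joint derivative -/

/-- If `uncurry w` is differentiable at `(t, x)` with derivative `L`, the slice `w t` is
differentiable at `x` with derivative `L ∘ (0, ·)` (chain rule with `y ↦ (t, y)`). [folklore] -/
theorem hasFDerivAt_slice {L : ℝ × X →L[ℝ] F} (h : HasFDerivAt (uncurry w) L (t, x)) :
    HasFDerivAt (w t) (L.comp (ContinuousLinearMap.inr ℝ ℝ X)) x :=
  h.comp x (hasFDerivAt_prodMk_right t x)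

/-- If `uncurry w` is differentiable at `(t, x)` with derivative `L`, the time line `s ↦ w s x`
has derivative `L (1, 0)` at `t` (chain rule with `s ↦ (s, x)`). [folklore] -/
theorem hasDerivAt_timeLine {L : ℝ × X →L[ℝ] F} (h : HasFDerivAt (uncurry w) L (t, x)) :
    HasDerivAt (fun s => w s x) (L (1, 0)) t := by
  have h2 := (h.comp t (hasFDerivAt_prodMk_left t x)).hasDerivAt
  have h3 : (uncurry w ∘ fun e => (e, x)) = fun s => w s x := rfl
  rw [h3] at h2
  simpa using h2

/-- Within a time set `S`: if `uncurry w` is differentiable within `S ×ˢ univ` at `(t, x)`,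
`t ∈ S`, with derivative `L`, then the slice `w t` has derivative `L ∘ (0, ·)` at `x`. [folklore] -/
theorem hasFDerivAt_slice_of_hasFDerivWithinAt {S : Set ℝ} {L : ℝ × X →L[ℝ] F}
    (h : HasFDerivWithinAt (uncurry w) L (S ×ˢ univ) (t, x)) (ht : t ∈ S) :
    HasFDerivAt (w t) (L.comp (ContinuousLinearMap.inr ℝ ℝ X)) x := by
  have h2 : HasFDerivWithinAt (fun y : X => (t, y)) (ContinuousLinearMap.inr ℝ ℝ X) univ x :=
    (hasFDerivAt_prodMk_right t x).hasFDerivWithinAt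
  exact hasFDerivWithinAt_univ.1 (h.comp x h2 fun y _ => mk_mem_prod ht (mem_univ y))

/-- Within a time set `S`: the time line `s ↦ w s x` has derivative `L (1, 0)` within `S` at
`t`. [folklore] -/
theorem hasDerivWithinAt_timeLine_of_hasFDerivWithinAt {S : Set ℝ} {L : ℝ × X →L[ℝ] F}
    (h : HasFDerivWithinAt (uncurry w) L (S ×ˢ univ) (t, x)) :
    HasDerivWithinAt (fun s => w s x) (L (1, 0)) S t := by
  have h2 : HasFDerivWithinAt (fun s : ℝ => (s, x)) (ContinuousLinearMap.inl ℝ ℝ X) S t :=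
    (hasFDerivAt_prodMk_left t x).hasFDerivWithinAt
  have h4 := (h.comp t h2 fun s hs => mk_mem_prod hs (mem_univ x)).hasDerivWithinAt
  have h3 : (uncurry w ∘ fun s => (s, x)) = fun s => w s x := rfl
  rw [h3] at h4
  simpa using h4

/-! ### Fields smooth on an open time set -/

variable {S : Set ℝ}

/-- On an open time set, a jointly smooth field is `C^∞` at every point of `S × X`. [folklore] -/
theorem IsSmoothSpaceTimeOn.contDiffAt (h : IsSmoothSpaceTimeOn S w) (hS : IsOpen S)
    (ht : t ∈ S) (x : X) : ContDiffAt ℝ ∞ (uncurry w) (t, x) :=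
  (h (t, x) (mk_mem_prod ht (mem_univ x))).contDiffAt
    ((hS.prod isOpen_univ).mem_nhds (mk_mem_prod ht (mem_univ x)))

/-- On an open time set, the joint derivative `D(uncurry w)` is differentiable at every point of
`S × X` (the field is jointly `C^∞`). [folklore] -/
theorem IsSmoothSpaceTimeOn.differentiableAt_fderiv_uncurry (h : IsSmoothSpaceTimeOn S w)
    (hS : IsOpen S) (ht : t ∈ S) (x : X) :
    DifferentiableAt ℝ (fderiv ℝ (uncurry w)) (t, x) := by
  have hU : IsOpen (S ×ˢ (univ : Set X)) := hS.prod isOpen_univ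
  exact ((h.fderiv_of_isOpen hU (m := 1) (ENat.natCast_le_of_coe_top_le_withTop le_rfl _)
    ).differentiableOn one_ne_zero (t, x) (mk_mem_prod ht (mem_univ x))).differentiableAt
      (hU.mem_nhds (mk_mem_prod ht (mem_univ x)))

/-- On an open time set: `D(w t)(x) = D(uncurry w)(t, x) ∘ (0, ·)` (the `fderiv` counterpart of
the tree's `IsSmoothSpaceTimeOn.fderiv_slice_eq`, which is stated with `fderivWithin`). [folklore] -/
theorem IsSmoothSpaceTimeOn.fderiv_slice_of_isOpen (h : IsSmoothSpaceTimeOn S w) (hS : IsOpen S)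
    (ht : t ∈ S) (x : X) :
    fderiv ℝ (w t) x = (fderiv ℝ (uncurry w) (t, x)).comp (ContinuousLinearMap.inr ℝ ℝ X) :=
  (hasFDerivAt_slice ((h.contDiffAt hS ht x).differentiableAt (by simp)).hasFDerivAt).fderiv

/-- On an open time set: `D(w t)(x) a = D(uncurry w)(t, x) (0, a)`. [folklore] -/
theorem IsSmoothSpaceTimeOn.fderiv_slice_apply_of_isOpen (h : IsSmoothSpaceTimeOn S w)
    (hS : IsOpen S) (ht : t ∈ S) (x : X) (a : X) :
    fderiv ℝ (w t) x a = fderiv ℝ (uncurry w) (t, x) (0, a) := by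
  rw [h.fderiv_slice_of_isOpen hS ht x]
  simp

/-- On an open time set: `∂ₜ w(t, x) = D(uncurry w)(t, x) (1, 0)`. [folklore] -/
theorem IsSmoothSpaceTimeOn.deriv_timeLine (h : IsSmoothSpaceTimeOn S w) (hS : IsOpen S)
    (ht : t ∈ S) (x : X) :
    deriv (fun s => w s x) t = fderiv ℝ (uncurry w) (t, x) (1, 0) :=
  (hasDerivAt_timeLine ((h.contDiffAt hS ht x).differentiableAt (by simp)).hasFDerivAt).deriv

/-- On an open time set, every time line `s ↦ w s x` of a jointly smooth field is
differentiable at `t ∈ S` (with derivative `deriv (w · x) t`). [folklore] -/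
theorem IsSmoothSpaceTimeOn.hasDerivAt_timeLine (h : IsSmoothSpaceTimeOn S w) (hS : IsOpen S)
    (ht : t ∈ S) (x : X) :
    HasDerivAt (fun s => w s x) (deriv (fun s => w s x) t) t :=
  (FluidPDE.hasDerivAt_timeLine ((h.contDiffAt hS ht x).differentiableAt
    (by simp)).hasFDerivAt).differentiableAt.hasDerivAt

omit [NormedAddCommGroup X] [NormedSpace ℝ X] in
/-- On an open time set the one-sided time derivative is the two-sided one:
`timeDerivWithin S w t x = ∂ₜ w(t, x)`. [folklore] -/
theorem timeDerivWithin_eq_deriv (hS : IsOpen S) (ht : t ∈ S) (w : ℝ → X → F) (x : X) :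
    timeDerivWithin S w t x = deriv (fun s => w s x) t :=
  derivWithin_of_mem_nhds (hS.mem_nhds ht)

omit [NormedAddCommGroup X] [NormedSpace ℝ X] in
/-- The one-sided time derivative within a time set `S'` that is a neighbourhood of `t` (e.g.
`S' = Icc 0 T` at an interior time `t ∈ Ioo 0 T`) is the two-sided one. [folklore] -/
theorem timeDerivWithin_eq_deriv_of_mem_nhds {S' : Set ℝ} (hS' : S' ∈ 𝓝 t) (w : ℝ → X → F)
    (x : X) : timeDerivWithin S' w t x = deriv (fun s => w s x) t :=
  derivWithin_of_mem_nhds hS'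

/-- On an open time set, the spatial partial derivative `(t, x) ↦ D(w t)(x) a` of a jointly
smooth field is jointly smooth (it is `z ↦ D(uncurry w)(z)(0, a)` there). [folklore] -/
theorem IsSmoothSpaceTimeOn.isSmoothSpaceTimeOn_fderiv_apply (h : IsSmoothSpaceTimeOn S w)
    (hS : IsOpen S) (a : X) :
    IsSmoothSpaceTimeOn S fun t x => fderiv ℝ (w t) x a := by
  have hU : IsOpen (S ×ˢ (univ : Set X)) := hS.prod isOpen_univ
  have h1 : ContDiffOn ℝ ∞ (fun z => fderiv ℝ (uncurry w) z (0, a)) (S ×ˢ univ) :=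
    (h.fderiv_of_isOpen hU (by simp)).clm_apply contDiffOn_const
  refine h1.congr ?_
  rintro ⟨t, x⟩ ⟨ht, -⟩
  exact h.fderiv_slice_apply_of_isOpen hS ht x a

/-- On an open time set, the operator-valued slice derivative `(t, x) ↦ D(w t)(x)` of a jointly
smooth field is jointly smooth (it is `z ↦ D(uncurry w)(z) ∘ (0, ·)` there; the `UniqueDiffOn`
counterpart is the tree's `IsSmoothSpaceTimeOn.fderiv_slice`). [folklore] -/
theorem IsSmoothSpaceTimeOn.isSmoothSpaceTimeOn_fderiv_of_isOpen (h : IsSmoothSpaceTimeOn S w)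
    (hS : IsOpen S) : IsSmoothSpaceTimeOn S fun t x => fderiv ℝ (w t) x :=
  h.fderiv_slice hS.uniqueDiffOn

/-- On an open time set, the time derivative `(t, x) ↦ ∂ₜ w(t, x)` of a jointly smooth field is
jointly smooth (it is `z ↦ D(uncurry w)(z)(1, 0)` there). [folklore] -/
theorem IsSmoothSpaceTimeOn.isSmoothSpaceTimeOn_deriv (h : IsSmoothSpaceTimeOn S w) (hS : IsOpen S) :
    IsSmoothSpaceTimeOn S fun t x => deriv (fun s => w s x) t := by
  have hU : IsOpen (S ×ˢ (univ : Set X)) := hS.prod isOpen_univ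
  have h1 : ContDiffOn ℝ ∞ (fun z => fderiv ℝ (uncurry w) z (1, 0)) (S ×ˢ univ) :=
    (h.fderiv_of_isOpen hU (by simp)).clm_apply contDiffOn_const
  refine h1.congr ?_
  rintro ⟨t, x⟩ ⟨ht, -⟩
  exact h.deriv_timeLine hS ht x

/-- The second-order dictionary, spatial-then-temporal: on an open time set,
`∂ₜ (D(w ·)(x) a) (t) = D²(uncurry w)(t, x) (1, 0) (0, a)`. [folklore] -/
theorem IsSmoothSpaceTimeOn.deriv_fderiv_slice_apply (h : IsSmoothSpaceTimeOn S w)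
    (hS : IsOpen S) (ht : t ∈ S) (x : X) (a : X) :
    deriv (fun s => fderiv ℝ (w s) x a) t =
      fderiv ℝ (fderiv ℝ (uncurry w)) (t, x) (1, 0) (0, a) := by
  have hU : IsOpen (S ×ˢ (univ : Set X)) := hS.prod isOpen_univ
  -- the field `∂ₐ w` and its time line
  have h1 := (h.isSmoothSpaceTimeOn_fderiv_apply hS a).deriv_timeLine hS ht x
  rw [h1]
  -- `uncurry (∂ₐ w) = D(uncurry w)(·)(0, a)` near `(t, x)`
  have heq : uncurry (fun t x => fderiv ℝ (w t) x a) =ᶠ[𝓝 (t, x)]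
      fun z => fderiv ℝ (uncurry w) z (0, a) := by
    filter_upwards [hU.mem_nhds (mk_mem_prod ht (mem_univ x))] with z hz
    exact h.fderiv_slice_apply_of_isOpen hS hz.1 z.2 a
  rw [heq.fderiv_eq,
    fderiv_clm_apply (h.differentiableAt_fderiv_uncurry hS ht x) (differentiableAt_const _)]
  simp

/-- The second-order dictionary, temporal-then-spatial: on an open time set,
`D(∂ₜ w(t, ·))(x) a = D²(uncurry w)(t, x) (0, a) (1, 0)`. [folklore] -/
theorem IsSmoothSpaceTimeOn.fderiv_deriv_slice_apply (h : IsSmoothSpaceTimeOn S w)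
    (hS : IsOpen S) (ht : t ∈ S) (x : X) (a : X) :
    fderiv ℝ (fun y => deriv (fun s => w s y) t) x a =
      fderiv ℝ (fderiv ℝ (uncurry w)) (t, x) (0, a) (1, 0) := by
  have hU : IsOpen (S ×ˢ (univ : Set X)) := hS.prod isOpen_univ
  have h1 := (h.isSmoothSpaceTimeOn_deriv hS).fderiv_slice_apply_of_isOpen hS ht x a
  rw [h1]
  have heq : uncurry (fun t x => deriv (fun s => w s x) t) =ᶠ[𝓝 (t, x)]
      fun z => fderiv ℝ (uncurry w) z (1, 0) := by
    filter_upwards [hU.mem_nhds (mk_mem_prod ht (mem_univ x))] with z hz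
    exact h.deriv_timeLine hS hz.1 z.2
  rw [heq.fderiv_eq,
    fderiv_clm_apply (h.differentiableAt_fderiv_uncurry hS ht x) (differentiableAt_const _)]
  simp

/-- Schwarz's theorem for the jointly smooth field on an open time set: the second joint
derivative of `uncurry w` at `(t, x)` is symmetric. [folklore] -/
theorem IsSmoothSpaceTimeOn.isSymmSndFDerivAt (h : IsSmoothSpaceTimeOn S w) (hS : IsOpen S)
    (ht : t ∈ S) (x : X) : IsSymmSndFDerivAt ℝ (uncurry w) (t, x) :=
  (h.contDiffAt hS ht x).isSymmSndFDerivAt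
    (by rw [minSmoothness_of_isRCLikeNormedField]; exact ENat.natCast_le_of_coe_top_le_withTop le_rfl 2)

/-- **Exchange of `∂ₜ` and `∂ₐ` (Schwarz).** For a field jointly smooth on an open time set,
`∂ₜ (∂ₐ w) = ∂ₐ (∂ₜ w)` pointwise on `S × X`:
`deriv (fun s ↦ D(w s)(x) a) t = D(fun y ↦ ∂ₜ w(t, y))(x) a` (symmetry of the second derivative
of the jointly `C²` map `uncurry w`, Mathlib `ContDiffAt.isSymmSndFDerivAt`; Evans, *PDE*,
App. C.1). [folklore] -/
theorem IsSmoothSpaceTimeOn.deriv_fderiv_slice_eq_fderiv_deriv (h : IsSmoothSpaceTimeOn S w)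
    (hS : IsOpen S) (ht : t ∈ S) (x : X) (a : X) :
    deriv (fun s => fderiv ℝ (w s) x a) t = fderiv ℝ (fun y => deriv (fun s => w s y) t) x a := by
  rw [h.deriv_fderiv_slice_apply hS ht x a, h.fderiv_deriv_slice_apply hS ht x a]
  exact h.isSymmSndFDerivAt hS ht x (1, 0) (0, a)

/-- **Exchange of `∂ₜ` and `∂ₐ`, `HasDerivAt` form**: on an open time set, the time line of the
spatial partial derivative `s ↦ D(w s)(x) a` has derivative `D(∂ₜ w(t, ·))(x) a` at `t`. [folklore] -/
theorem IsSmoothSpaceTimeOn.hasDerivAt_fderiv_slice (h : IsSmoothSpaceTimeOn S w)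
    (hS : IsOpen S) (ht : t ∈ S) (x : X) (a : X) :
    HasDerivAt (fun s => fderiv ℝ (w s) x a) (fderiv ℝ (fun y => deriv (fun s => w s y) t) x a) t := by
  rw [← h.deriv_fderiv_slice_eq_fderiv_deriv hS ht x a]
  exact (h.isSmoothSpaceTimeOn_fderiv_apply hS a).hasDerivAt_timeLine hS ht x

/-- **Exchange of `∂ₜ` and `D`, operator-valued form**: on an open time set, the time line of the
slice derivative `s ↦ D(w s)(x) ∈ X →L[ℝ] F` has derivative `D(∂ₜ w(t, ·))(x)` at `t`
(`d/dt ∇u = ∇ ∂ₜu`, the form in which the vorticity equation `∂ₜ ω = curl ∂ₜ u` is derived;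
Evans, *PDE*, App. C.1). Proof: `D(w s)(x) = D(uncurry w)(s, x) ∘ (0, ·)`, the first factor is a
differentiable function of `s` with derivative `D²(uncurry w)(t, x)(1, 0)`, and Schwarz's theorem
identifies `D²(uncurry w)(t,x)(1,0)(0,a)` with `D(∂ₜw(t,·))(x) a = D²(uncurry w)(t,x)(0,a)(1,0)`. [folklore] -/
theorem IsSmoothSpaceTimeOn.hasDerivAt_fderiv_slice_clm (h : IsSmoothSpaceTimeOn S w)
    (hS : IsOpen S) (ht : t ∈ S) (x : X) :
    HasDerivAt (fun s => fderiv ℝ (w s) x) (fderiv ℝ (fun y => deriv (fun s => w s y) t) x) t := by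
  have hU : IsOpen (S ×ˢ (univ : Set X)) := hS.prod isOpen_univ
  -- the operator-valued time line `s ↦ D(uncurry w)(s, x)` and its derivative
  set W : ℝ → X → (ℝ × X →L[ℝ] F) := fun s y => fderiv ℝ (uncurry w) (s, y) with hW
  have hWd : HasFDerivAt (uncurry W) (fderiv ℝ (fderiv ℝ (uncurry w)) (t, x)) (t, x) := by
    have : uncurry W = fderiv ℝ (uncurry w) := by
      funext z; rfl
    rw [this]
    exact (h.differentiableAt_fderiv_uncurry hS ht x).hasFDerivAt
  have hc : HasDerivAt (fun s => W s x) (fderiv ℝ (fderiv ℝ (uncurry w)) (t, x) (1, 0)) t :=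
    FluidPDE.hasDerivAt_timeLine hWd
  -- compose with the constant operator `(0, ·)`
  have hd : HasDerivAt (fun _ : ℝ => ContinuousLinearMap.inr ℝ ℝ X) 0 t := hasDerivAt_const _ _
  have hcomp := hc.clm_comp hd
  simp only [ContinuousLinearMap.comp_zero, add_zero] at hcomp
  -- `D(w s)(x) = W s x ∘ (0, ·)` for `s ∈ S`
  have heq : (fun s => (W s x).comp (ContinuousLinearMap.inr ℝ ℝ X)) =ᶠ[𝓝 t]
      fun s => fderiv ℝ (w s) x := by
    filter_upwards [hS.mem_nhds ht] with s hs
    exact (h.fderiv_slice_of_isOpen hS hs x).symm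
  refine (hcomp.congr_of_eventuallyEq heq.symm).congr_deriv ?_
  -- identify the derivative by Schwarz's theorem
  ext a
  rw [ContinuousLinearMap.comp_apply, ContinuousLinearMap.inr_apply,
    h.fderiv_deriv_slice_apply hS ht x a]
  exact h.isSymmSndFDerivAt hS ht x (1, 0) (0, a)

/-! ### Continuity up to the boundary of the time set -/

/-- On a time set of unique differentiability (e.g. `Icc 0 T`, `T > 0`), the spatial derivative
of a jointly smooth field is jointly continuous **up to the boundary**:
`(t, x) ↦ D(w t)(x)` is continuous on `S × X` (from the tree's `IsSmoothSpaceTimeOn.fderiv_slice`). [folklore] -/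
theorem IsSmoothSpaceTimeOn.continuousOn_fderiv_slice (h : IsSmoothSpaceTimeOn S w)
    (hS : UniqueDiffOn ℝ S) :
    ContinuousOn (fun z : ℝ × X => fderiv ℝ (w z.1) z.2) (S ×ˢ univ) :=
  (h.fderiv_slice hS).continuousOn

/-- On a time set of unique differentiability, the one-sided time derivative of a jointly smooth
field is jointly continuous up to the boundary: `(t, x) ↦ timeDerivWithin S w t x` is continuous
on `S × X` (from the tree's `IsSmoothSpaceTimeOn.timeDerivWithin`). [folklore] -/
theorem IsSmoothSpaceTimeOn.continuousOn_timeDerivWithin (h : IsSmoothSpaceTimeOn S w)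
    (hS : UniqueDiffOn ℝ S) :
    ContinuousOn (fun z : ℝ × X => FluidPDE.timeDerivWithin S w z.1 z.2) (S ×ˢ univ) :=
  (h.timeDerivWithin hS).continuousOn

omit [NormedAddCommGroup X] [NormedSpace ℝ X] in
/-- **Interior times of a slab.** A field jointly smooth on a time set `S'` is jointly smooth on
any open `S ⊆ S'`, and there its one-sided time derivative within `S'` is the two-sided one:
for `t ∈ S`, `timeDerivWithin S' w t = fun y ↦ ∂ₜ w(t, y)` (as slice functions). Typical use:
`S' = Icc 0 T`, `S = Ioo 0 T`. [folklore] -/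
theorem timeDerivWithin_eq_deriv_of_isOpen_subset {S' : Set ℝ} (hS : IsOpen S) (hSS' : S ⊆ S')
    (ht : t ∈ S) (w : ℝ → X → F) :
    timeDerivWithin S' w t = fun y => deriv (fun s => w s y) t := by
  funext y
  exact derivWithin_of_mem_nhds (mem_of_superset (hS.mem_nhds ht) hSS')

/-- On an open `S ⊆ S'`, the time line of the slice derivative of a field jointly smooth on `S'`
has derivative `D(timeDerivWithin S' w t)(x)` at every `t ∈ S` (operator-valued exchange of
`∂ₜ` and `D` at interior times of a slab). [folklore] -/
theorem IsSmoothSpaceTimeOn.hasDerivAt_fderiv_slice_timeDerivWithin {S' : Set ℝ}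
    (h : IsSmoothSpaceTimeOn S' w) (hS : IsOpen S) (hSS' : S ⊆ S') (ht : t ∈ S) (x : X) :
    HasDerivAt (fun s => fderiv ℝ (w s) x) (fderiv ℝ (FluidPDE.timeDerivWithin S' w t) x) t := by
  rw [timeDerivWithin_eq_deriv_of_isOpen_subset hS hSS' ht w]
  exact (h.mono hSS').hasDerivAt_fderiv_slice_clm hS ht x

/-! ### Algebra of jointly smooth fields (complements `ClassicalSolutionCalculus`) -/

/-- A time-independent smooth field is jointly smooth on any time set. [folklore] -/
theorem isSmoothSpaceTimeOn_const_time {φ : X → F} (hφ : ContDiff ℝ ∞ φ)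
    (S : Set ℝ) : IsSmoothSpaceTimeOn S fun (_ : ℝ) x => φ x :=
  (hφ.comp contDiff_snd).contDiffOn

/-- Scalar multiples (by a jointly smooth scalar field) of jointly smooth fields are jointly
smooth. [folklore] -/
theorem IsSmoothSpaceTimeOn.smul {c : ℝ → X → ℝ} (hc : IsSmoothSpaceTimeOn S c)
    (h : IsSmoothSpaceTimeOn S w) : IsSmoothSpaceTimeOn S fun t x => c t x • w t x :=
  ContDiffOn.smul hc h

/-- Products of jointly smooth scalar fields are jointly smooth. [folklore] -/
theorem IsSmoothSpaceTimeOn.mul {c c' : ℝ → X → ℝ} (hc : IsSmoothSpaceTimeOn S c)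
    (hc' : IsSmoothSpaceTimeOn S c') : IsSmoothSpaceTimeOn S fun t x => c t x * c' t x :=
  ContDiffOn.mul hc hc'

/-- A fixed continuous linear map applied to a jointly smooth field is jointly smooth. [folklore] -/
theorem IsSmoothSpaceTimeOn.clm {G : Type*} [NormedAddCommGroup G] [NormedSpace ℝ G]
    (h : IsSmoothSpaceTimeOn S w) (L : F →L[ℝ] G) : IsSmoothSpaceTimeOn S fun t x => L (w t x) :=
  L.contDiff.comp_contDiffOn h

/-- Inner products of jointly smooth fields are jointly smooth. [folklore] -/
theorem IsSmoothSpaceTimeOn.inner {F' : Type*} [NormedAddCommGroup F'] [InnerProductSpace ℝ F']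
    {v v' : ℝ → X → F'} (h : IsSmoothSpaceTimeOn S v) (h' : IsSmoothSpaceTimeOn S v') :
    IsSmoothSpaceTimeOn S fun t x => (inner ℝ (v t x) (v' t x) : ℝ) :=
  ContDiffOn.inner ℝ h h'

end Slices

/-! ### Parametric integrals of fields with uniformly compact spatial support -/

section Parametric

variable {X : Type*} [NormedAddCommGroup X] [NormedSpace ℝ X] [MeasurableSpace X]
  [OpensMeasurableSpace X]
variable {F : Type*} [NormedAddCommGroup F] [NormedSpace ℝ F]
variable {μ : Measure X} [IsLocallyFiniteMeasure μ]

omit [NormedSpace ℝ X] in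
/-- **Continuity of a parametric integral.** If `(t, x) ↦ Φ t x` is continuous on `S × X` and
the slices `Φ t`, `t ∈ S`, are supported in a fixed compact set `K`, then `t ↦ ∫ Φ t x ∂μ` is
continuous on `S` (Mathlib
`continuousOn_integral_bilinear_of_locally_integrable_of_compact_support` with the pairing
`(1, v) ↦ v`). [folklore] -/
theorem continuousOn_integral_of_support_subset [CompleteSpace F] {Φ : ℝ → X → F} {S : Set ℝ}
    {K : Set X} (hK : IsCompact K) (hΦ : ContinuousOn (uncurry Φ) (S ×ˢ univ))
    (hsupp : ∀ t ∈ S, ∀ x ∉ K, Φ t x = 0) :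
    ContinuousOn (fun t => ∫ x, Φ t x ∂μ) S := by
  have h := continuousOn_integral_bilinear_of_locally_integrable_of_compact_support
    (μ := μ) (ContinuousLinearMap.lsmul ℝ ℝ) (g := fun _ : X => (1 : ℝ)) hK hΦ
    (fun t x ht hx => hsupp t ht x hx) (integrableOn_const hK.measure_lt_top.ne)
  simpa using h

/-- **Differentiation under the integral sign** for jointly smooth fields with uniformly compact
spatial support: if `Φ` is jointly smooth on an open time set `S` and the slices `Φ t`, `t ∈ S`,
are supported in a fixed compact set `K`, then for `t ∈ S`,
`d/dt ∫ Φ t x ∂μ = ∫ ∂ₜΦ(t, x) ∂μ` (Mathlib `hasDerivAt_integral_of_dominated_loc_of_deriv_le`,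
dominated on a compact time-neighbourhood by the maximum of the continuous `∂ₜΦ` on
`[t - δ, t + δ] × K`; Evans, *PDE*, §7.1.2 (b), the computation `d/dt ∫ …`). [folklore] -/
theorem hasDerivAt_integral_of_support_subset [CompleteSpace F] [SecondCountableTopologyEither X F]
    {Φ : ℝ → X → F} {S : Set ℝ}
    (hS : IsOpen S) (hΦ : IsSmoothSpaceTimeOn S Φ) {K : Set X} (hK : IsCompact K)
    (hsupp : ∀ t ∈ S, ∀ x ∉ K, Φ t x = 0) {t : ℝ} (ht : t ∈ S) :
    HasDerivAt (fun s => ∫ x, Φ s x ∂μ) (∫ x, deriv (fun s => Φ s x) t ∂μ) t := by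
  -- a compact time-neighbourhood `[t - δ, t + δ] ⊆ S`
  obtain ⟨δ, hδ, hball⟩ := Metric.isOpen_iff.1 hS t ht
  have hIcc : Icc (t - δ / 2) (t + δ / 2) ⊆ S := fun s hs => hball <| by
    rw [Metric.mem_ball, Real.dist_eq, abs_lt]
    constructor <;> linarith [hs.1, hs.2]
  have hnhds : Icc (t - δ / 2) (t + δ / 2) ∈ 𝓝 t := Icc_mem_nhds (by linarith) (by linarith)
  -- the time derivative field and its continuity
  set Φ' : ℝ → X → F := fun s x => deriv (fun r => Φ r x) s with hΦ'
  have hΦ'smooth : IsSmoothSpaceTimeOn S Φ' := hΦ.isSmoothSpaceTimeOn_deriv hS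
  have hΦ'cont : ContinuousOn (uncurry Φ') (S ×ˢ univ) := hΦ'smooth.continuousOn
  -- slices are continuous
  have hslice : ∀ s ∈ S, Continuous (Φ s) := fun s hs =>
    (hΦ.contDiff_slice hs).continuous
  have hslice' : ∀ s ∈ S, Continuous (Φ' s) := fun s hs =>
    (hΦ'smooth.contDiff_slice hs).continuous
  -- `Φ' s x = 0` off `K`
  have hsupp' : ∀ s ∈ S, ∀ x ∉ K, Φ' s x = 0 := by
    intro s hs x hx
    have : (fun r => Φ r x) =ᶠ[𝓝 s] fun _ => (0 : F) := by
      filter_upwards [hS.mem_nhds hs] with r hr using hsupp r hr x hx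
    show deriv (fun r => Φ r x) s = 0
    rw [this.deriv_eq, deriv_const]
  -- a uniform bound for `Φ'` on `[t - δ/2, t + δ/2] × K`
  obtain ⟨M, hM⟩ : ∃ M, ∀ z ∈ Icc (t - δ / 2) (t + δ / 2) ×ˢ K, ‖uncurry Φ' z‖ ≤ M :=
    (isCompact_Icc.prod hK).exists_bound_of_continuousOn
      (hΦ'cont.mono (prod_mono hIcc (subset_univ _)))
  -- dominated differentiation
  have key := hasDerivAt_integral_of_dominated_loc_of_deriv_le (μ := μ) (F := Φ) (F' := Φ')
    (x₀ := t) (bound := K.indicator fun _ => M) hnhds ?_ ?_ ?_ ?_ ?_ ?_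
  · exact key.2
  · filter_upwards [hS.mem_nhds ht] with s hs using (hslice s hs).aestronglyMeasurable
  · exact (hslice t ht).integrable_of_hasCompactSupport (HasCompactSupport.intro hK (hsupp t ht))
  · exact (hslice' t ht).aestronglyMeasurable
  · refine Eventually.of_forall fun x s hs => ?_
    by_cases hx : x ∈ K
    · rw [indicator_of_mem hx]
      exact hM (s, x) (mk_mem_prod hs hx)
    · rw [indicator_of_notMem hx, hsupp' s (hIcc hs) x hx, norm_zero]
  · exact (integrable_indicator_iff hK.measurableSet).2
      (integrableOn_const hK.measure_lt_top.ne)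
  · refine Eventually.of_forall fun x s hs => ?_
    exact (hasDerivAt_timeLine ((hΦ.contDiffAt hS (hIcc hs) x).differentiableAt
      (by simp)).hasFDerivAt).differentiableAt.hasDerivAt

end Parametric

end Literature.Analysis.FluidPDE

end
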